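import Mathlib
import HarnessLib
import Summits.HubbardSuperconductivity.HubbardSuperconductivity.Theorems.KLProgrammeKLRegimeEnginePairTransferOutClassCapShares
import Summits.HubbardSuperconductivity.HubbardSuperconductivity.Theorems.KLProgrammeKLRegimeSplitThermalLayer

/-!
# K3 ENGINE (stmt-HubbardSuperconductivity-20437 `KLRegimeEngineV17F2`), row (c) binder #9 `hexOutPkgι`: kernel certificate of the arithmetic of LOCATED #22
# «(c)-OUT-NEAR-SLICE-LEGS», sub-rows (A) «LEG-DRESSING» and (B) «SIGMA-DOMAIN/CAPS» (cell gate-hubbard-kl, seat gate-hubbard-kl-p1 g28; finder k3c2-p2 g30,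
# memo `HOME/hubbard-kl-k3c2-p2/g30/LOCATED-C-OUT-NEAR-SLICE-LEGS.md`, x-reads J g30 / T2-2 g24; the analogue of `…EnginePhGainBelowResolution` (#23) and `…EngineSixLegThresholdNoHome` (#24))

WHAT.  Binder `hexOutPkgι` of `A24a1G14.stub_engine_step_values_of_producers_pkg₁₇` (tree `Theorems/KLProgrammeKLRegimeEngineV17F2ClosersVGQOutI.lean`, binder of
`EngineV8.rowC_hexOut_of_pkgι`), per scale `n`, member `j`, pin `(x, y)`, has among its ∃-data `RH A₀S : ℝ` with the rows
* l.87  `∀ t ∈ Icc 0 1, ‖Hd j t ![(((ω₀,y),0),0), …]‖ ≤ RH` (`Hd` pinned to the «≥ 2 cross lines» fold whose `1`-term is the LEG DRESSING `Sg(ℓ)·∂_ΛC_t(ℓ)·V`);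
* l.133 `(klScale klE0 n − klScale klE0 (n+1))·(2⁻¹·RH) ≤ 4⁻¹·(klEngGeo11.cloc·(P.Klam·U)²·4^{−(klEngGeo11.θ·n)})` («hShareHd»);
* l.123 `∀ t k, ‖Σ_σ V6 j t ![((ω₀,k),σ,±), pinned] · Sg j t (ω₀,k) σ‖ ≤ A₀S` and l.131 `A₀S ≤ 2²⁴·(P.Klam·U)³`;
with `klEngGeo11.cloc = 2¹⁰`, `klEngGeo11.θ = ½` (`klEngGeo11_cloc_eq`, `klEngGeo11_θ_eq`, `rpow_four_neg_half_mul` — tree lemmas used BY NAME) and `klScale klE0 n = (1/32)·4⁻ⁿ`.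
PAPER-LEVEL premises of located #22 (OF RECORD (R596)/(R597); NOT tree theorems, hence HYPOTHESES below):
(PA) §1: for a pinned leg `ℓ` ON the `Λ_t`-shell (`0 < Λt ≤ klScale klE0 n`) `‖Hd …‖ ≥ κ·U³/Λ_t`, `κ = κ_C·c_Z ≈ ½` [est] — typed `κ * U ^ 3 / Λt ≤ hd`, `hd ≤ RH`;
(PB) §2: at an OFF-shell `k`, for a pinned leg with `E_ℓ ≍ Λₙ₊₁` (`0 < Eℓ ≤ klScale klE0 (n+1)`), `‖Σ_σ V6·Sg‖ ≥ s·U⁴/E_ℓ`, `s ≈ 0.05` [est] — typed `s * U ^ 4 / Eℓ ≤ y₀`, `y₀ ≤ A₀S`.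
THEOREMS (arithmetic on the VERBATIM rows, `P.Klam ↦ Klam`): `x22a_forces_shallow_scale` ⟹ `(3/8)·κ·U·2ⁿ ≤ 2⁸·Klam²`; `x22a_no_home_nominal`: `False` for `n ≥ 86` at
`U = 2⁻⁷⁵`, `κ ≥ ½`, `Klam = 1` (#22 §1 «fails for n ≳ 86 + 2log₂Klam»); `x22a_consistent_at_85`; `x22b_cap_forces_shallow_scale` ⟹ `s·U·4^{n+1} ≤ 2¹⁹·Klam³`;
`x22b_no_home_nominal`: `False` for `n ≥ 49` at `U = 2⁻⁷⁵`, `s ≥ 1/20`, `Klam = 1` (#22 §2 «n ≳ 48 + (3/2)log₂Klam»); `x22b_consistent_at_48`.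
Sub-row (C) («SIGMA-ODDNESS», route losses at `n − 2m ≳ 133`) is not certified here (its sizes are route-internal estimates).
Honest framing: arithmetic over `rfl`-level tree lemmas; (PA)(PB) and the sizes `κ`, `s` are hypotheses; nothing here asserts or refutes row (c), binder #9, any row of 20437, K3, U₀,
the window, a margin or superconductivity in the Hubbard model.  0 kit · 0 lit.  [cite: BenfattoGiulianiMastropietro2006]
-/

noncomputable section

namespace Summit.HubbardSuperconductivity.HubbardSuperconductivity.Theorems.EngineV8

set_option linter.dupNamespace false -- summit = problem name (single-conjunct summit), D-0017

open Summit.HubbardSuperconductivity.HubbardSuperconductivity.Theorems.KLRegimeSplit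
open Summit.HubbardSuperconductivity.HubbardSuperconductivity.Theorems.KLProgrammeLegKernels

/-- `Λₙ − Λₙ₊₁ = ¾·Λₙ` for the engine's scales `klScale klE0`. -/
theorem x22a_klScale_sub_succ (n : ℕ) : klScale klE0 n - klScale klE0 (n + 1) = 3 / 4 * klScale klE0 n := by
  unfold klScale; rw [pow_succ]; field_simp; ring

/-- **(A) general currencies.** Row l.133 («hShareHd») with l.87 and the premise (PA) for a pinned leg on the `Λ_t`-shell (`Λt ≤ Λₙ`) forces
`(3/8)·κ·U·2ⁿ ≤ 2⁸·Klam²`. -/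
theorem x22a_forces_shallow_scale {RH hd κ Λt U Klam : ℝ} {n : ℕ} (hU : 0 < U) (hκ : 0 < κ) (hΛt : 0 < Λt) (hΛtn : Λt ≤ klScale klE0 n)
    (h87 : hd ≤ RH) (hPA : κ * U ^ 3 / Λt ≤ hd)
    (h133 : (klScale klE0 n - klScale klE0 (n + 1)) * (2⁻¹ * RH) ≤ 4⁻¹ * (klEngGeo11.cloc * (Klam * U) ^ 2 * (4 : ℝ) ^ (-(klEngGeo11.θ * n)))) :
    3 / 8 * κ * U * 2 ^ n ≤ 2 ^ 8 * Klam ^ 2 := by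
  rw [klEngGeo11_cloc_eq, klEngGeo11_θ_eq, rpow_four_neg_half_mul, x22a_klScale_sub_succ] at h133
  have hΛn := klth_klScale_pos n
  have h2n : (0 : ℝ) < 2 ^ n := by positivity
  -- (PA) at the weakest shell `Λt ≤ Λₙ`: `κ·U³/Λₙ ≤ RH`
  have hRH : κ * U ^ 3 / klScale klE0 n ≤ RH := by
    have h1 : κ * U ^ 3 / klScale klE0 n ≤ κ * U ^ 3 / Λt :=
      div_le_div_of_nonneg_left (by positivity) hΛt hΛtn
    linarith
  -- the row's left side is then ≥ (3/8)·κ·U³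
  have hL : 3 / 8 * κ * U ^ 3 ≤ 3 / 4 * klScale klE0 n * (2⁻¹ * RH) := by
    have h2 : 3 / 4 * klScale klE0 n * (2⁻¹ * (κ * U ^ 3 / klScale klE0 n)) = 3 / 8 * κ * U ^ 3 := by
      field_simp; ring
    rw [← h2]
    exact mul_le_mul_of_nonneg_left (mul_le_mul_of_nonneg_left hRH (by norm_num)) (by positivity)
  have hR : 3 / 8 * κ * U ^ 3 ≤ 4⁻¹ * (2 ^ 10 * (Klam * U) ^ 2 * ((2 : ℝ) ^ n)⁻¹) := hL.trans h133
  -- clear denominators: multiply by `2ⁿ/U²`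
  have hU2 : (0 : ℝ) < U ^ 2 := by positivity
  have key : 3 / 8 * κ * U * 2 ^ n * U ^ 2 ≤ 2 ^ 8 * Klam ^ 2 * U ^ 2 := by
    have h3 : 4⁻¹ * (2 ^ 10 * (Klam * U) ^ 2 * ((2 : ℝ) ^ n)⁻¹) * 2 ^ n = 2 ^ 8 * Klam ^ 2 * U ^ 2 := by
      field_simp; ring
    have h4 : 3 / 8 * κ * U ^ 3 * 2 ^ n = 3 / 8 * κ * U * 2 ^ n * U ^ 2 := by ring
    have := mul_le_mul_of_nonneg_right hR h2n.le
    rw [h3, h4] at this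
    exact this
  exact le_of_mul_le_mul_right key hU2

/-- **(A) NOMINAL point ⇒ NO HOME for every `n ≥ 86`** (`U = 2⁻⁷⁵`, `κ ≥ ½`, `Klam = 1`): `(3/8)·κ·2^{n−75} ≤ 2⁸` fails from `n = 86` on. -/
theorem x22a_no_home_nominal {RH hd κ Λt U Klam : ℝ} {n : ℕ} (hUnom : U = 1 / 2 ^ 75) (hκ : 1 / 2 ≤ κ) (hKlam : Klam = 1) (hn : 86 ≤ n)
    (hΛt : 0 < Λt) (hΛtn : Λt ≤ klScale klE0 n) (h87 : hd ≤ RH) (hPA : κ * U ^ 3 / Λt ≤ hd)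
    (h133 : (klScale klE0 n - klScale klE0 (n + 1)) * (2⁻¹ * RH) ≤ 4⁻¹ * (klEngGeo11.cloc * (Klam * U) ^ 2 * (4 : ℝ) ^ (-(klEngGeo11.θ * n)))) : False := by
  have hU : 0 < U := by rw [hUnom]; positivity
  have hb := x22a_forces_shallow_scale hU (by linarith) hΛt hΛtn h87 hPA h133
  rw [hKlam, hUnom] at hb
  have h86 : (2 : ℝ) ^ 86 ≤ 2 ^ n := pow_le_pow_right₀ (by norm_num) hn
  nlinarith

/-- The nominal band starts at 86: at `n = 85`, `κ = ½` the necessary inequality still holds (`(3/8)·½·2^{85−75} = 192 ≤ 256`). -/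
theorem x22a_consistent_at_85 : 3 / 8 * (1 / 2 : ℝ) * (1 / 2 ^ 75) * 2 ^ 85 ≤ 2 ^ 8 * (1 : ℝ) ^ 2 := by norm_num

/-- **(B) «SIGMA-DOMAIN/CAPS», general currencies.** Rows l.123 (`‖Σ_σ V6·Sg‖ ≤ A₀S` at every `k`, in particular an OFF-shell `k`) and l.131 (`A₀S ≤ 2²⁴·(Klam·U)³`)
with located #22 §2's premise (PB) `|Y(k_off)| ≥ s·U⁴/E_ℓ` for a pinned leg `ℓ` with `E_ℓ ≍ Λₙ₊₁` (`0 < Eℓ ≤ klScale klE0 (n+1)`; `s ≈ 0.05` [est]) force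
`s·U·4^{n+1} ≤ 2¹⁹·Klam³`. -/
theorem x22b_cap_forces_shallow_scale {A₀S y₀ s Eℓ U Klam : ℝ} {n : ℕ} (hU : 0 < U) (hs : 0 < s) (hE : 0 < Eℓ) (hEn : Eℓ ≤ klScale klE0 (n + 1))
    (h123 : y₀ ≤ A₀S) (hPB : s * U ^ 4 / Eℓ ≤ y₀) (h131 : A₀S ≤ 2 ^ 24 * (Klam * U) ^ 3) :
    s * U * 4 ^ (n + 1) ≤ 2 ^ 19 * Klam ^ 3 := by
  have hΛ := klth_klScale_pos (n + 1)
  have h1 : s * U ^ 4 / klScale klE0 (n + 1) ≤ s * U ^ 4 / Eℓ := div_le_div_of_nonneg_left (by positivity) hE hEn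
  have h2 : s * U ^ 4 / klScale klE0 (n + 1) ≤ 2 ^ 24 * (Klam * U) ^ 3 := by linarith
  have h3 : s * U ^ 4 / klScale klE0 (n + 1) = s * U * 4 ^ (n + 1) * U ^ 3 * 32 := by
    unfold klScale klE0; field_simp
  rw [h3] at h2
  have hU3 : (0 : ℝ) < U ^ 3 * 32 := by positivity
  have h4 : 2 ^ 24 * (Klam * U) ^ 3 = 2 ^ 19 * Klam ^ 3 * (U ^ 3 * 32) := by ring
  rw [h4] at h2
  have h5 : s * U * 4 ^ (n + 1) * U ^ 3 * 32 = s * U * 4 ^ (n + 1) * (U ^ 3 * 32) := by ring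
  rw [h5] at h2
  exact le_of_mul_le_mul_right h2 hU3

/-- **(B) NOMINAL point ⇒ NO HOME for every `n ≥ 49`** (`U = 2⁻⁷⁵`, `s ≥ 1/20`, `Klam = 1`; #22 §2: «cap fails for n ≳ 48 + (3/2)log₂Klam»). -/
theorem x22b_no_home_nominal {A₀S y₀ s Eℓ U Klam : ℝ} {n : ℕ} (hUnom : U = 1 / 2 ^ 75) (hs : 1 / 20 ≤ s) (hKlam : Klam = 1) (hn : 49 ≤ n)
    (hE : 0 < Eℓ) (hEn : Eℓ ≤ klScale klE0 (n + 1)) (h123 : y₀ ≤ A₀S) (hPB : s * U ^ 4 / Eℓ ≤ y₀) (h131 : A₀S ≤ 2 ^ 24 * (Klam * U) ^ 3) :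
    False := by
  have hU : 0 < U := by rw [hUnom]; positivity
  have hb := x22b_cap_forces_shallow_scale hU (by linarith) hE hEn h123 hPB h131
  rw [hKlam, hUnom] at hb
  have h50 : (4 : ℝ) ^ 50 ≤ 4 ^ (n + 1) := pow_le_pow_right₀ (by norm_num) (by omega)
  nlinarith

/-- The (B) band starts at 49: at `n = 48`, `s = 1/20` the necessary inequality still holds (`2⁻⁷⁵·4⁴⁹/20 ≤ 2¹⁹`). -/
theorem x22b_consistent_at_48 : (1 / 20 : ℝ) * (1 / 2 ^ 75) * 4 ^ (48 + 1) ≤ 2 ^ 19 * (1 : ℝ) ^ 3 := by norm_num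

end Summit.HubbardSuperconductivity.HubbardSuperconductivity.Theorems.EngineV8
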